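import Mathlib
import HarnessLib
import Summits.Ventures.LatticeQCDFlow.Exactness.SU2WilsonFlowLOSubstep
import Summits.Ventures.LatticeQCDFlow.Exactness.SU2ResidualLayer
import Summits.Ventures.LatticeQCDFlow.Exactness.SU2LeapfrogFTHMCErgodic

/-!
# The booked Jacobian of a masked `SU(2)` kick layer is pinched; field-transformed single-step leapfrog HMC through the engine's layers is uniformly ergodic

HONEST FRAMING: exact (Metropolis-corrected) sampling algorithms for lattice gauge theory;
figures of merit are autocorrelation/cost numbers at stated couplings and volumes; no
continuum-physics claim.

Venture `LatticeQCDFlow` (cell pub-lqcd), topic `Exactness`; FANOUT row 14 (`eng-flowhmc`, engine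
`latflow.fthmc`, family B).  NEW WORK of the cell; nothing is cited as a fact; no number.
"Ergodicity" has been on the NOT-CLAIMED list of every row-14 file.  Row 9's
`SU2LeapfrogFTHMCErgodic.su2LeapfrogFTHMC_uniformlyErgodic` proves uniform ergodicity of the
REPORTED single-step leapfrog FT-HMC kernel on `SU(2)^ι` for ANY measurable equivalence `F` whose
certified Jacobian is PINCHED, `0 < j₁ ≤ J ≤ j₂`, any bounded measurable action and bounded
measurable momentum increment — and lists "which members `F` the engine certifies" as not claimed.
This file supplies the pinch for the engine's masked `SU(2)` kick layers (LO Wilson-flow sub-steps,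
learned residual layers: `SU2MaskedKickLayer.lean`) from a UNIFORM refusal bound
`|ε| ‖J‖ ≤ κ₀ < 1`, and draws the conclusion:

* `su2KickJacFix_mem_Icc` — the repaired per-link density `j̃(κ, θ)` lies in
  `[(1 − |κ|)³, (1 + |κ|)³]` for `|κ| ≤ 1`, `θ ∈ [0, π]` (`|sin(θ − κ sin θ) − sin θ| ≤ |κ| sin θ`);
* **`su2MaskedKickJacobian_mem_Icc`** — the booked layer density (verbatim as certified in
  `SU2MaskedKickLayer.lean`) lies in `[(1 − κ₀)^(3n), (1 + κ₀)^(3n)]`, `n` = number of active links;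
* **`su2MaskedKick_fthmc_uniformlyErgodic`** — for links `ι` (finite), any mask, any frozen
  measurable field `J` with `|ε| ‖J V i‖ ≤ κ₀ < 1` at active links, any measurable action
  `|S| ≤ s`, any measurable momentum increment `‖g‖ ≤ b`, `ε', κ' > 0`: the layer is a measurable
  equivalence `F` and the reported kernel `F ∘ K_(S∘F − log J) ∘ F⁻¹` of row 9's single-step
  leapfrog HMC satisfies `|μ₀ K̃ᵗ(A) − π_S(A)| ≤ (1 − δ)ᵗ` for some `δ ∈ (0, 1]`, every initial law,
  every `t`, every `A`; **`su2MaskedKick_fthmc_invariant_unique`** — `π_S` is its only invariant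
  probability law;
* **`su2WilsonFlowLOSubstep_fthmc_uniformlyErgodic`** — the instance: the engine's LO Wilson-flow
  sub-step `(μ, b)` of `su2WilsonFlowLOSubstep_certified` (VERBATIM map and booked density), proper
  colouring, `2(d−1)|ε| < 1` (`κ₀ = 2(d−1)|ε|` by `norm_stapleJ_le`);
  **`su2ResidualLayer_fthmc_uniformlyErgodic`** — the learned residual layer of
  `su2ResidualLayer_certified` (VERBATIM) under the uniform bound `|c| Σ|ρ| ≤ κ₀ < 1`.

NOT CLAIMED: multi-step trajectories (`nstep ≥ 2`), OMF words, whole schedules (the composite's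
density is pinched too — a product — but row 9's kernel is stated for one `F`), the engine's
momentum normalisation versus row 9's `(ε', κ')`, any usable `δ`, floating point, `SU(N ≥ 3)`,
any number.
-/

noncomputable section

namespace Summit.Ventures.LatticeQCDFlow.Exactness

open Real Set MeasureTheory Measure InnerProductGeometry ProbabilityTheory ProbabilityTheory.Kernel
open Literature.MathematicalPhysics.QuantumFieldTheory
open scoped ENNReal Matrix

/-! ## The repaired per-link density is pinched -/

section Pinch

/-- **`(1 − |κ|)³ ≤ j̃(κ, θ) ≤ (1 + |κ|)³`** for the repaired per-link density of an `SU(2)` kick,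
`|κ| ≤ 1`, `θ ∈ [0, π]`: both printed factors are within `|κ|` of `1`
(`|κ cos θ| ≤ |κ|`, `|sin(θ − κ sin θ)/sin θ − 1| ≤ |κ|`). -/
theorem su2KickJacFix_mem_Icc {κ θ : ℝ} (hκ : |κ| ≤ 1) (hθ : θ ∈ Icc 0 π) :
    (if Real.sin θ = 0 then (1 - κ * Real.cos θ) ^ 3 else kickJac κ 2 θ) ∈
      Icc ((1 - |κ|) ^ 3) ((1 + |κ|) ^ 3) := by
  have hc1 : |κ * Real.cos θ| ≤ |κ| := by
    rw [abs_mul]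
    exact mul_le_of_le_one_right (abs_nonneg κ) (Real.abs_cos_le_one θ)
  have hlo : 1 - |κ| ≤ 1 - κ * Real.cos θ := by linarith [le_abs_self (κ * Real.cos θ)]
  have hhi : 1 - κ * Real.cos θ ≤ 1 + |κ| := by linarith [neg_abs_le (κ * Real.cos θ)]
  have h0 : 0 ≤ 1 - |κ| := by linarith
  split_ifs with hs
  · exact ⟨pow_le_pow_left₀ h0 hlo 3, pow_le_pow_left₀ (h0.trans hlo) hhi 3⟩
  · have hsin : 0 < Real.sin θ :=
      lt_of_le_of_ne (Real.sin_nonneg_of_nonneg_of_le_pi hθ.1 hθ.2) (Ne.symm hs)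
    have hdiff : |Real.sin (kickAngle κ θ) - Real.sin θ| ≤ |κ| * Real.sin θ := by
      have h := Real.abs_sin_sub_sin_le (kickAngle κ θ) θ
      rw [kickAngle_apply, show θ - κ * Real.sin θ - θ = -(κ * Real.sin θ) by ring, abs_neg, abs_mul,
        abs_of_pos hsin] at h
      exact h
    have hr_lo : 1 - |κ| ≤ Real.sin (kickAngle κ θ) / Real.sin θ := by
      rw [le_div_iff₀ hsin]
      have := (abs_le.mp hdiff).1
      linarith
    have hr_hi : Real.sin (kickAngle κ θ) / Real.sin θ ≤ 1 + |κ| := by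
      rw [div_le_iff₀ hsin]
      have := (abs_le.mp hdiff).2
      linarith
    have hr0 : 0 ≤ Real.sin (kickAngle κ θ) / Real.sin θ := h0.trans hr_lo
    unfold kickJac
    constructor
    · calc (1 - |κ|) ^ 3 = (1 - |κ|) * (1 - |κ|) ^ 2 := by ring
        _ ≤ (1 - κ * Real.cos θ) * (Real.sin (kickAngle κ θ) / Real.sin θ) ^ 2 :=
          mul_le_mul hlo (pow_le_pow_left₀ h0 hr_lo 2) (pow_nonneg h0 2) (h0.trans hlo)
    · calc (1 - κ * Real.cos θ) * (Real.sin (kickAngle κ θ) / Real.sin θ) ^ 2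
          ≤ (1 + |κ|) * (1 + |κ|) ^ 2 :=
          mul_le_mul hhi (pow_le_pow_left₀ hr0 hr_hi 2) (pow_nonneg hr0 2) (by positivity)
        _ = (1 + |κ|) ^ 3 := by ring

variable {ι : Type*} [Fintype ι] (p : ι → Prop) [DecidablePred p]

/-- **The booked density of a masked `SU(2)` kick layer is pinched**: under the uniform refusal
bound `|ε| ‖J V i‖ ≤ κ₀ ≤ 1` at active links,
`(1 − κ₀)^(3n) ≤ ∏_active j̃ ≤ (1 + κ₀)^(3n)`, `n = #active links`. -/
theorem su2MaskedKickJacobian_mem_Icc {ε κ₀ : ℝ} (J : (ι → Matrix.specialUnitaryGroup (Fin 2) ℂ) → ι → R4) (hκ₀ : κ₀ ≤ 1)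
    (hκ : ∀ (V : ι → Matrix.specialUnitaryGroup (Fin 2) ℂ) (i : ι), p i → |ε| * ‖J V i‖ ≤ κ₀) (V : ι → Matrix.specialUnitaryGroup (Fin 2) ℂ) :
    (∏ a : {i // p i},
          (if Real.sin (angle (J V a.1) (vecQuat ((V a.1 : Matrix.specialUnitaryGroup (Fin 2) ℂ) : Matrix (Fin 2) (Fin 2) ℂ))) = 0 then
              (1 - ε * ‖J V a.1‖ * Real.cos (angle (J V a.1) (vecQuat ((V a.1 : Matrix.specialUnitaryGroup (Fin 2) ℂ) : Matrix (Fin 2) (Fin 2) ℂ)))) ^ 3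
            else kickJac (ε * ‖J V a.1‖) 2 (angle (J V a.1) (vecQuat ((V a.1 : Matrix.specialUnitaryGroup (Fin 2) ℂ) : Matrix (Fin 2) (Fin 2) ℂ))))) ∈
      Icc ((1 - κ₀) ^ (3 * Fintype.card {i // p i})) ((1 + κ₀) ^ (3 * Fintype.card {i // p i})) := by
  have hfac : ∀ a : {i // p i},
      (if Real.sin (angle (J V a.1) (vecQuat ((V a.1 : Matrix.specialUnitaryGroup (Fin 2) ℂ) : Matrix (Fin 2) (Fin 2) ℂ))) = 0 then
              (1 - ε * ‖J V a.1‖ * Real.cos (angle (J V a.1) (vecQuat ((V a.1 : Matrix.specialUnitaryGroup (Fin 2) ℂ) : Matrix (Fin 2) (Fin 2) ℂ)))) ^ 3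
            else kickJac (ε * ‖J V a.1‖) 2 (angle (J V a.1) (vecQuat ((V a.1 : Matrix.specialUnitaryGroup (Fin 2) ℂ) : Matrix (Fin 2) (Fin 2) ℂ)))) ∈ Icc ((1 - κ₀) ^ 3) ((1 + κ₀) ^ 3) := by
    intro a
    have hk : |ε * ‖J V a.1‖| ≤ κ₀ := by
      rw [abs_mul, abs_norm]
      exact hκ V a.1 a.2
    have h := su2KickJacFix_mem_Icc (κ := ε * ‖J V a.1‖)
      (θ := angle (J V a.1) (vecQuat ((V a.1 : Matrix.specialUnitaryGroup (Fin 2) ℂ) : Matrix (Fin 2) (Fin 2) ℂ))) (hk.trans hκ₀)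
      ⟨angle_nonneg _ _, angle_le_pi _ _⟩
    have h1 : (1 - κ₀) ^ 3 ≤ (1 - |ε * ‖J V a.1‖|) ^ 3 := pow_le_pow_left₀ (by linarith) (by linarith) 3
    have h2 : (1 + |ε * ‖J V a.1‖|) ^ 3 ≤ (1 + κ₀) ^ 3 := pow_le_pow_left₀ (by positivity) (by linarith) 3
    exact ⟨h1.trans h.1, h.2.trans h2⟩
  constructor
  · calc (1 - κ₀) ^ (3 * Fintype.card {i // p i}) = ∏ _a : {i // p i}, (1 - κ₀) ^ 3 := by
          rw [Finset.prod_const, Finset.card_univ, ← pow_mul]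
      _ ≤ _ := Finset.prod_le_prod (fun a _ => pow_nonneg (by linarith) 3) fun a _ => (hfac a).1
  · calc (∏ a : {i // p i},
          (if Real.sin (angle (J V a.1) (vecQuat ((V a.1 : Matrix.specialUnitaryGroup (Fin 2) ℂ) : Matrix (Fin 2) (Fin 2) ℂ))) = 0 then
              (1 - ε * ‖J V a.1‖ * Real.cos (angle (J V a.1) (vecQuat ((V a.1 : Matrix.specialUnitaryGroup (Fin 2) ℂ) : Matrix (Fin 2) (Fin 2) ℂ)))) ^ 3
            else kickJac (ε * ‖J V a.1‖) 2 (angle (J V a.1) (vecQuat ((V a.1 : Matrix.specialUnitaryGroup (Fin 2) ℂ) : Matrix (Fin 2) (Fin 2) ℂ)))))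
          ≤ ∏ _a : {i // p i}, (1 + κ₀) ^ 3 :=
          Finset.prod_le_prod (fun a _ => (pow_nonneg (by linarith) 3).trans (hfac a).1) fun a _ => (hfac a).2
      _ = (1 + κ₀) ^ (3 * Fintype.card {i // p i}) := by rw [Finset.prod_const, Finset.card_univ, ← pow_mul]

end Pinch

/-! ## FT-HMC through a masked kick layer is uniformly ergodic -/

section Ergodic

variable {ι : Type*} [Fintype ι] (p : ι → Prop) [DecidablePred p]

/-- **Field-transformed single-step leapfrog HMC through a masked `SU(2)` kick layer is uniformly
ergodic.**  Links `ι` (finite), mask `p`, frozen measurable field `J` with the UNIFORM refusal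
bound `|ε| ‖J V i‖ ≤ κ₀ < 1` at active links; row 9's kernel data: step `ε' > 0`, momentum
parameter `κ' > 0`, measurable momentum increment `g` with `‖g‖ ≤ b`, measurable action `|S| ≤ s`.
Then the layer is a measurable equivalence `F` (forward map = the masked kick) and the REPORTED
kernel `F ∘ K_(S∘F − log J) ∘ F⁻¹` converges geometrically in total variation to
`π_S = Z⁻¹ e^(−S) Haar^(⊗ι)` from every initial law. -/
theorem su2MaskedKick_fthmc_uniformlyErgodic {ε κ₀ : ℝ} (J : (ι → Matrix.specialUnitaryGroup (Fin 2) ℂ) → ι → R4)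
    (hJm : ∀ i, p i → Measurable fun V : ι → Matrix.specialUnitaryGroup (Fin 2) ℂ => J V i)
    (hJloc : ∀ V W : ι → Matrix.specialUnitaryGroup (Fin 2) ℂ, (∀ j, ¬p j → V j = W j) → ∀ i, p i → J V i = J W i)
    (hκ₀ : κ₀ < 1) (hκ : ∀ (V : ι → Matrix.specialUnitaryGroup (Fin 2) ℂ) (i : ι), p i → |ε| * ‖J V i‖ ≤ κ₀)
    {ε' κ' : ℝ} (hε' : 0 < ε') (hκ' : 0 < κ')
    {g : (ι → Matrix.specialUnitaryGroup (Fin 2) ℂ) → ι → EuclideanSpace ℝ (Fin 3)} (hg : Measurable g) {b : ℝ} (hb0 : 0 ≤ b)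
    (hb : ∀ u l, ‖g u l‖ ≤ b) {S : (ι → Matrix.specialUnitaryGroup (Fin 2) ℂ) → ℝ} (hS : Measurable S) {s : ℝ} (hs : ∀ u, |S u| ≤ s) :
    ∃ F : (ι → Matrix.specialUnitaryGroup (Fin 2) ℂ) ≃ᵐ (ι → Matrix.specialUnitaryGroup (Fin 2) ℂ),
      (⇑F = fun (V : ι → Matrix.specialUnitaryGroup (Fin 2) ℂ) (i : ι) =>
        if p i then gaussUnit (geodesicKick ε (J V i)
          (vecQuat ((V i : Matrix.specialUnitaryGroup (Fin 2) ℂ) : Matrix (Fin 2) (Fin 2) ℂ)))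
        else V i) ∧
      ∃ δ : ℝ, 0 < δ ∧ δ ≤ 1 ∧ ∀ (μ₀ : Measure (ι → Matrix.specialUnitaryGroup (Fin 2) ℂ)) [IsProbabilityMeasure μ₀] (t : ℕ) (A : Set (ι → Matrix.specialUnitaryGroup (Fin 2) ℂ)),
        |((fun m : Measure (ι → Matrix.specialUnitaryGroup (Fin 2) ℂ) =>
              m.bind (conjKernel (su2LeapfrogHMC ε' κ' hg fun v => S (F v) - Real.log (∏ a : {i // p i},
          (if Real.sin (angle (J v a.1) (vecQuat ((v a.1 : Matrix.specialUnitaryGroup (Fin 2) ℂ) : Matrix (Fin 2) (Fin 2) ℂ))) = 0 then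
              (1 - ε * ‖J v a.1‖ * Real.cos (angle (J v a.1) (vecQuat ((v a.1 : Matrix.specialUnitaryGroup (Fin 2) ℂ) : Matrix (Fin 2) (Fin 2) ℂ)))) ^ 3
            else kickJac (ε * ‖J v a.1‖) 2 (angle (J v a.1) (vecQuat ((v a.1 : Matrix.specialUnitaryGroup (Fin 2) ℂ) : Matrix (Fin 2) (Fin 2) ℂ)))))) F))^[t] μ₀).real A
            - (su2GibbsLaw S).real A| ≤ (1 - δ) ^ t := by
  have hlt : ∀ (V : ι → Matrix.specialUnitaryGroup (Fin 2) ℂ) (i : ι), p i → |ε| * ‖J V i‖ < 1 :=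
    fun V i hi => (hκ V i hi).trans_lt hκ₀
  obtain ⟨F, hF, hJac, -, hmeas⟩ := exists_measurableEquiv_su2MaskedKick p J hJm hJloc hlt
  refine ⟨F, hF, ?_⟩
  have hpinch := fun V => su2MaskedKickJacobian_mem_Icc p J hκ₀.le hκ V
  exact su2LeapfrogFTHMC_uniformlyErgodic hε' hκ' hg hb0 hb hS hs
    (pow_pos (by linarith) _) (fun v => (hpinch v).1) (fun v => (hpinch v).2) hmeas hJac

/-- **… and `π_S` is the unique invariant probability law of that reported kernel.** -/
theorem su2MaskedKick_fthmc_invariant_unique {ε κ₀ : ℝ} (J : (ι → Matrix.specialUnitaryGroup (Fin 2) ℂ) → ι → R4)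
    (hJm : ∀ i, p i → Measurable fun V : ι → Matrix.specialUnitaryGroup (Fin 2) ℂ => J V i)
    (hJloc : ∀ V W : ι → Matrix.specialUnitaryGroup (Fin 2) ℂ, (∀ j, ¬p j → V j = W j) → ∀ i, p i → J V i = J W i)
    (hκ₀ : κ₀ < 1) (hκ : ∀ (V : ι → Matrix.specialUnitaryGroup (Fin 2) ℂ) (i : ι), p i → |ε| * ‖J V i‖ ≤ κ₀)
    {ε' κ' : ℝ} (hε' : 0 < ε') (hκ' : 0 < κ')
    {g : (ι → Matrix.specialUnitaryGroup (Fin 2) ℂ) → ι → EuclideanSpace ℝ (Fin 3)} (hg : Measurable g) {b : ℝ} (hb0 : 0 ≤ b)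
    (hb : ∀ u l, ‖g u l‖ ≤ b) {S : (ι → Matrix.specialUnitaryGroup (Fin 2) ℂ) → ℝ} (hS : Measurable S) {s : ℝ} (hs : ∀ u, |S u| ≤ s) :
    ∃ F : (ι → Matrix.specialUnitaryGroup (Fin 2) ℂ) ≃ᵐ (ι → Matrix.specialUnitaryGroup (Fin 2) ℂ),
      (⇑F = fun (V : ι → Matrix.specialUnitaryGroup (Fin 2) ℂ) (i : ι) =>
        if p i then gaussUnit (geodesicKick ε (J V i)
          (vecQuat ((V i : Matrix.specialUnitaryGroup (Fin 2) ℂ) : Matrix (Fin 2) (Fin 2) ℂ)))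
        else V i) ∧
      ∀ (π' : Measure (ι → Matrix.specialUnitaryGroup (Fin 2) ℂ)) [IsProbabilityMeasure π'],
        Invariant (conjKernel (su2LeapfrogHMC ε' κ' hg fun v => S (F v) - Real.log (∏ a : {i // p i},
          (if Real.sin (angle (J v a.1) (vecQuat ((v a.1 : Matrix.specialUnitaryGroup (Fin 2) ℂ) : Matrix (Fin 2) (Fin 2) ℂ))) = 0 then
              (1 - ε * ‖J v a.1‖ * Real.cos (angle (J v a.1) (vecQuat ((v a.1 : Matrix.specialUnitaryGroup (Fin 2) ℂ) : Matrix (Fin 2) (Fin 2) ℂ)))) ^ 3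
            else kickJac (ε * ‖J v a.1‖) 2 (angle (J v a.1) (vecQuat ((v a.1 : Matrix.specialUnitaryGroup (Fin 2) ℂ) : Matrix (Fin 2) (Fin 2) ℂ)))))) F) π' →
        π' = su2GibbsLaw S := by
  have hlt : ∀ (V : ι → Matrix.specialUnitaryGroup (Fin 2) ℂ) (i : ι), p i → |ε| * ‖J V i‖ < 1 :=
    fun V i hi => (hκ V i hi).trans_lt hκ₀
  obtain ⟨F, hF, hJac, -, hmeas⟩ := exists_measurableEquiv_su2MaskedKick p J hJm hJloc hlt
  refine ⟨F, hF, fun π' _ hπ' => ?_⟩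
  have hpinch := fun V => su2MaskedKickJacobian_mem_Icc p J hκ₀.le hκ V
  exact su2LeapfrogFTHMC_invariant_unique hε' hκ' hg hb0 hb hS hs
    (pow_pos (by linarith) _) (fun v => (hpinch v).1) (fun v => (hpinch v).2) hmeas hJac hπ'

end Ergodic

/-! ## The engine's LO sub-step -/

section LO

variable {d L : ℕ} {X : Type*} [DecidableEq X] (χ : Site d L → X) [NeZero L]

/-- **FT-HMC (row 9's single-step leapfrog kernel) through the engine's masked `SU(2)` Wilson-flow
sub-step `(μ, b)` is uniformly ergodic.**  Proper colouring `χ`, `2(d−1)|ε| < 1` (so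
`κ₀ = 2(d−1)|ε|` by `norm_stapleJ_le`); any measurable action `|S| ≤ s` on `GaugeConfig d L SU(2)`
(e.g. `β·S_W`), any measurable momentum increment `‖g‖ ≤ b`, `ε', κ' > 0`. -/
theorem su2WilsonFlowLOSubstep_fthmc_uniformlyErgodic
    (hχ : ∀ (x : Site d L) (i : Fin d), χ (x.shift i) ≠ χ x) (μ : Fin d) (b : X) {ε : ℝ}
    (hε : |ε| * (2 * ((d - 1 : ℕ) : ℝ)) < 1)
    {ε' κ' : ℝ} (hε' : 0 < ε') (hκ' : 0 < κ')
    {g : GaugeConfig d L (Matrix.specialUnitaryGroup (Fin 2) ℂ) → Edge d L → EuclideanSpace ℝ (Fin 3)} (hg : Measurable g) {b' : ℝ} (hb0 : 0 ≤ b')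
    (hb : ∀ u l, ‖g u l‖ ≤ b') {S : GaugeConfig d L (Matrix.specialUnitaryGroup (Fin 2) ℂ) → ℝ} (hS : Measurable S) {s : ℝ} (hs : ∀ u, |S u| ≤ s) :
    ∃ F : GaugeConfig d L (Matrix.specialUnitaryGroup (Fin 2) ℂ) ≃ᵐ GaugeConfig d L (Matrix.specialUnitaryGroup (Fin 2) ℂ),
      (⇑F = fun (V : GaugeConfig d L ((Matrix.specialUnitaryGroup (Fin 2) ℂ))) (e : Edge d L) =>
        if e.2 = μ ∧ χ e.1 = b then
          gaussUnit (geodesicKick ε (∑ ν ∈ Finset.univ.erase e.2,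
            (vecQuat (((V (Site.shift e.1 e.2, ν) * (V (Site.shift e.1 ν, e.2))⁻¹ * (V (e.1, ν))⁻¹)⁻¹ : (Matrix.specialUnitaryGroup (Fin 2) ℂ)) : Matrix (Fin 2) (Fin 2) ℂ) +
              vecQuat ((((V (Site.shift (e.1 - Pi.single ν 1) e.2, ν))⁻¹ * (V (e.1 - Pi.single ν 1, e.2))⁻¹ * V (e.1 - Pi.single ν 1, ν))⁻¹ : (Matrix.specialUnitaryGroup (Fin 2) ℂ)) : Matrix (Fin 2) (Fin 2) ℂ)))
            (vecQuat ((V e : (Matrix.specialUnitaryGroup (Fin 2) ℂ)) : Matrix (Fin 2) (Fin 2) ℂ)))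
        else V e) ∧
      ∃ δ : ℝ, 0 < δ ∧ δ ≤ 1 ∧ ∀ (μ₀ : Measure (GaugeConfig d L (Matrix.specialUnitaryGroup (Fin 2) ℂ))) [IsProbabilityMeasure μ₀] (t : ℕ) (A : Set (GaugeConfig d L (Matrix.specialUnitaryGroup (Fin 2) ℂ))),
        |((fun m : Measure (GaugeConfig d L (Matrix.specialUnitaryGroup (Fin 2) ℂ)) =>
              m.bind (conjKernel (su2LeapfrogHMC ε' κ' hg fun V => S (F V) - Real.log (∏ a : {e : Edge d L // e.2 = μ ∧ χ e.1 = b},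
          (if Real.sin (angle (∑ ν ∈ Finset.univ.erase a.1.2,
            (vecQuat (((V (Site.shift a.1.1 a.1.2, ν) * (V (Site.shift a.1.1 ν, a.1.2))⁻¹ * (V (a.1.1, ν))⁻¹)⁻¹ : (Matrix.specialUnitaryGroup (Fin 2) ℂ)) : Matrix (Fin 2) (Fin 2) ℂ) +
              vecQuat ((((V (Site.shift (a.1.1 - Pi.single ν 1) a.1.2, ν))⁻¹ * (V (a.1.1 - Pi.single ν 1, a.1.2))⁻¹ * V (a.1.1 - Pi.single ν 1, ν))⁻¹ : (Matrix.specialUnitaryGroup (Fin 2) ℂ)) : Matrix (Fin 2) (Fin 2) ℂ))) (vecQuat ((V a.1 : (Matrix.specialUnitaryGroup (Fin 2) ℂ)) : Matrix (Fin 2) (Fin 2) ℂ))) = 0 then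
            (1 - ε * ‖(∑ ν ∈ Finset.univ.erase a.1.2,
            (vecQuat (((V (Site.shift a.1.1 a.1.2, ν) * (V (Site.shift a.1.1 ν, a.1.2))⁻¹ * (V (a.1.1, ν))⁻¹)⁻¹ : (Matrix.specialUnitaryGroup (Fin 2) ℂ)) : Matrix (Fin 2) (Fin 2) ℂ) +
              vecQuat ((((V (Site.shift (a.1.1 - Pi.single ν 1) a.1.2, ν))⁻¹ * (V (a.1.1 - Pi.single ν 1, a.1.2))⁻¹ * V (a.1.1 - Pi.single ν 1, ν))⁻¹ : (Matrix.specialUnitaryGroup (Fin 2) ℂ)) : Matrix (Fin 2) (Fin 2) ℂ)))‖ * Real.cos (angle (∑ ν ∈ Finset.univ.erase a.1.2,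
            (vecQuat (((V (Site.shift a.1.1 a.1.2, ν) * (V (Site.shift a.1.1 ν, a.1.2))⁻¹ * (V (a.1.1, ν))⁻¹)⁻¹ : (Matrix.specialUnitaryGroup (Fin 2) ℂ)) : Matrix (Fin 2) (Fin 2) ℂ) +
              vecQuat ((((V (Site.shift (a.1.1 - Pi.single ν 1) a.1.2, ν))⁻¹ * (V (a.1.1 - Pi.single ν 1, a.1.2))⁻¹ * V (a.1.1 - Pi.single ν 1, ν))⁻¹ : (Matrix.specialUnitaryGroup (Fin 2) ℂ)) : Matrix (Fin 2) (Fin 2) ℂ))) (vecQuat ((V a.1 : (Matrix.specialUnitaryGroup (Fin 2) ℂ)) : Matrix (Fin 2) (Fin 2) ℂ)))) ^ 3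
          else kickJac (ε * ‖(∑ ν ∈ Finset.univ.erase a.1.2,
            (vecQuat (((V (Site.shift a.1.1 a.1.2, ν) * (V (Site.shift a.1.1 ν, a.1.2))⁻¹ * (V (a.1.1, ν))⁻¹)⁻¹ : (Matrix.specialUnitaryGroup (Fin 2) ℂ)) : Matrix (Fin 2) (Fin 2) ℂ) +
              vecQuat ((((V (Site.shift (a.1.1 - Pi.single ν 1) a.1.2, ν))⁻¹ * (V (a.1.1 - Pi.single ν 1, a.1.2))⁻¹ * V (a.1.1 - Pi.single ν 1, ν))⁻¹ : (Matrix.specialUnitaryGroup (Fin 2) ℂ)) : Matrix (Fin 2) (Fin 2) ℂ)))‖) 2 (angle (∑ ν ∈ Finset.univ.erase a.1.2,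
            (vecQuat (((V (Site.shift a.1.1 a.1.2, ν) * (V (Site.shift a.1.1 ν, a.1.2))⁻¹ * (V (a.1.1, ν))⁻¹)⁻¹ : (Matrix.specialUnitaryGroup (Fin 2) ℂ)) : Matrix (Fin 2) (Fin 2) ℂ) +
              vecQuat ((((V (Site.shift (a.1.1 - Pi.single ν 1) a.1.2, ν))⁻¹ * (V (a.1.1 - Pi.single ν 1, a.1.2))⁻¹ * V (a.1.1 - Pi.single ν 1, ν))⁻¹ : (Matrix.specialUnitaryGroup (Fin 2) ℂ)) : Matrix (Fin 2) (Fin 2) ℂ))) (vecQuat ((V a.1 : (Matrix.specialUnitaryGroup (Fin 2) ℂ)) : Matrix (Fin 2) (Fin 2) ℂ)))))) F))^[t] μ₀).real A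
            - (su2GibbsLaw S).real A| ≤ (1 - δ) ^ t := by
  have h := su2MaskedKick_fthmc_uniformlyErgodic (fun e : Edge d L => e.2 = μ ∧ χ e.1 = b)
    (fun (V : GaugeConfig d L (Matrix.specialUnitaryGroup (Fin 2) ℂ)) (e : Edge d L) => ∑ ν ∈ Finset.univ.erase e.2,
        (vecQuat (((V (Site.shift e.1 e.2, ν) * (V (Site.shift e.1 ν, e.2))⁻¹ * (V (e.1, ν))⁻¹)⁻¹ : Matrix.specialUnitaryGroup (Fin 2) ℂ) : Matrix (Fin 2) (Fin 2) ℂ) +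
          vecQuat ((((V (Site.shift (e.1 - Pi.single ν 1) e.2, ν))⁻¹ * (V (e.1 - Pi.single ν 1, e.2))⁻¹ * V (e.1 - Pi.single ν 1, ν))⁻¹ : Matrix.specialUnitaryGroup (Fin 2) ℂ) : Matrix (Fin 2) (Fin 2) ℂ)))
    (fun e _ => (continuous_stapleJ e).measurable)
    (fun V W hVW e he => stapleJ_local χ hχ he hVW)
    hε (fun V e _ => mul_le_mul_of_nonneg_left (norm_stapleJ_le V e) (abs_nonneg ε))
    hε' hκ' hg hb0 hb hS hs
  beta_reduce at h
  exact h

end LO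

/-! ## The engine's learned residual layer -/

section Residual

variable {d L : ℕ} {X : Type*} [DecidableEq X] (χ : Site d L → X) [NeZero L]

/-- **FT-HMC (row 9's single-step leapfrog kernel) through a learned `SU(2)` residual layer
`(μ, b)` is uniformly ergodic** — weights `ρ` measurable and frozen as in
`su2ResidualLayer_certified`, with the UNIFORM refusal bound
`|c| Σ_ν (|ρ V e ν 0| + |ρ V e ν 1|) ≤ κ₀ < 1` at active links (the engine: `Σ|ρ| ≤ κ_target < 1`
by the `tanh` squashing, `c = 1`); any measurable `|S| ≤ s`, `‖g‖ ≤ b`, `ε', κ' > 0`. -/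
theorem su2ResidualLayer_fthmc_uniformlyErgodic
    (hχ : ∀ (x : Site d L) (i : Fin d), χ (x.shift i) ≠ χ x) (μ : Fin d) (b : X) {c κ₀ : ℝ}
    (ρ : GaugeConfig d L (Matrix.specialUnitaryGroup (Fin 2) ℂ) → Edge d L → Fin d → Fin 2 → ℝ)
    (hρm : ∀ e ν s, Measurable fun V : GaugeConfig d L (Matrix.specialUnitaryGroup (Fin 2) ℂ) => ρ V e ν s)
    (hρloc : ∀ V W : GaugeConfig d L (Matrix.specialUnitaryGroup (Fin 2) ℂ),
      (∀ j : Edge d L, ¬(j.2 = μ ∧ χ j.1 = b) → V j = W j) →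
        ∀ e : Edge d L, (e.2 = μ ∧ χ e.1 = b) → ∀ ν s, ρ V e ν s = ρ W e ν s)
    (hκ₀ : κ₀ < 1)
    (hκ : ∀ (V : GaugeConfig d L (Matrix.specialUnitaryGroup (Fin 2) ℂ)) (e : Edge d L), (e.2 = μ ∧ χ e.1 = b) →
      |c| * ∑ ν ∈ Finset.univ.erase e.2, (|ρ V e ν 0| + |ρ V e ν 1|) ≤ κ₀)
    {ε' κ' : ℝ} (hε' : 0 < ε') (hκ' : 0 < κ')
    {g : GaugeConfig d L (Matrix.specialUnitaryGroup (Fin 2) ℂ) → Edge d L → EuclideanSpace ℝ (Fin 3)} (hg : Measurable g) {b' : ℝ} (hb0 : 0 ≤ b')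
    (hb : ∀ u l, ‖g u l‖ ≤ b') {S : GaugeConfig d L (Matrix.specialUnitaryGroup (Fin 2) ℂ) → ℝ} (hS : Measurable S) {s : ℝ} (hs : ∀ u, |S u| ≤ s) :
    ∃ F : GaugeConfig d L (Matrix.specialUnitaryGroup (Fin 2) ℂ) ≃ᵐ GaugeConfig d L (Matrix.specialUnitaryGroup (Fin 2) ℂ),
      (⇑F = fun (V : GaugeConfig d L (Matrix.specialUnitaryGroup (Fin 2) ℂ)) (e : Edge d L) =>
        if e.2 = μ ∧ χ e.1 = b then
          gaussUnit (geodesicKick c (∑ ν ∈ Finset.univ.erase e.2,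
            (ρ V e ν 0 • vecQuat (((V (Site.shift e.1 e.2, ν) * (V (Site.shift e.1 ν, e.2))⁻¹ * (V (e.1, ν))⁻¹)⁻¹ : Matrix.specialUnitaryGroup (Fin 2) ℂ) : Matrix (Fin 2) (Fin 2) ℂ) +
              ρ V e ν 1 • vecQuat ((((V (Site.shift (e.1 - Pi.single ν 1) e.2, ν))⁻¹ * (V (e.1 - Pi.single ν 1, e.2))⁻¹ * V (e.1 - Pi.single ν 1, ν))⁻¹ : Matrix.specialUnitaryGroup (Fin 2) ℂ) : Matrix (Fin 2) (Fin 2) ℂ)))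
            (vecQuat ((V e : Matrix.specialUnitaryGroup (Fin 2) ℂ) : Matrix (Fin 2) (Fin 2) ℂ)))
        else V e) ∧
      ∃ δ : ℝ, 0 < δ ∧ δ ≤ 1 ∧ ∀ (μ₀ : Measure (GaugeConfig d L (Matrix.specialUnitaryGroup (Fin 2) ℂ))) [IsProbabilityMeasure μ₀] (t : ℕ) (A : Set (GaugeConfig d L (Matrix.specialUnitaryGroup (Fin 2) ℂ))),
        |((fun m : Measure (GaugeConfig d L (Matrix.specialUnitaryGroup (Fin 2) ℂ)) =>
              m.bind (conjKernel (su2LeapfrogHMC ε' κ' hg fun V => S (F V) - Real.log (∏ a : {e : Edge d L // e.2 = μ ∧ χ e.1 = b},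
        (if Real.sin (angle (∑ ν ∈ Finset.univ.erase a.1.2,
            (ρ V a.1 ν 0 • vecQuat (((V (Site.shift a.1.1 a.1.2, ν) * (V (Site.shift a.1.1 ν, a.1.2))⁻¹ * (V (a.1.1, ν))⁻¹)⁻¹ : Matrix.specialUnitaryGroup (Fin 2) ℂ) : Matrix (Fin 2) (Fin 2) ℂ) +
              ρ V a.1 ν 1 • vecQuat ((((V (Site.shift (a.1.1 - Pi.single ν 1) a.1.2, ν))⁻¹ * (V (a.1.1 - Pi.single ν 1, a.1.2))⁻¹ * V (a.1.1 - Pi.single ν 1, ν))⁻¹ : Matrix.specialUnitaryGroup (Fin 2) ℂ) : Matrix (Fin 2) (Fin 2) ℂ)))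
            (vecQuat ((V a.1 : Matrix.specialUnitaryGroup (Fin 2) ℂ) : Matrix (Fin 2) (Fin 2) ℂ))) = 0 then
            (1 - c * ‖∑ ν ∈ Finset.univ.erase a.1.2,
            (ρ V a.1 ν 0 • vecQuat (((V (Site.shift a.1.1 a.1.2, ν) * (V (Site.shift a.1.1 ν, a.1.2))⁻¹ * (V (a.1.1, ν))⁻¹)⁻¹ : Matrix.specialUnitaryGroup (Fin 2) ℂ) : Matrix (Fin 2) (Fin 2) ℂ) +
              ρ V a.1 ν 1 • vecQuat ((((V (Site.shift (a.1.1 - Pi.single ν 1) a.1.2, ν))⁻¹ * (V (a.1.1 - Pi.single ν 1, a.1.2))⁻¹ * V (a.1.1 - Pi.single ν 1, ν))⁻¹ : Matrix.specialUnitaryGroup (Fin 2) ℂ) : Matrix (Fin 2) (Fin 2) ℂ))‖ *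
              Real.cos (angle (∑ ν ∈ Finset.univ.erase a.1.2,
            (ρ V a.1 ν 0 • vecQuat (((V (Site.shift a.1.1 a.1.2, ν) * (V (Site.shift a.1.1 ν, a.1.2))⁻¹ * (V (a.1.1, ν))⁻¹)⁻¹ : Matrix.specialUnitaryGroup (Fin 2) ℂ) : Matrix (Fin 2) (Fin 2) ℂ) +
              ρ V a.1 ν 1 • vecQuat ((((V (Site.shift (a.1.1 - Pi.single ν 1) a.1.2, ν))⁻¹ * (V (a.1.1 - Pi.single ν 1, a.1.2))⁻¹ * V (a.1.1 - Pi.single ν 1, ν))⁻¹ : Matrix.specialUnitaryGroup (Fin 2) ℂ) : Matrix (Fin 2) (Fin 2) ℂ)))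
            (vecQuat ((V a.1 : Matrix.specialUnitaryGroup (Fin 2) ℂ) : Matrix (Fin 2) (Fin 2) ℂ)))) ^ 3
          else kickJac (c * ‖∑ ν ∈ Finset.univ.erase a.1.2,
            (ρ V a.1 ν 0 • vecQuat (((V (Site.shift a.1.1 a.1.2, ν) * (V (Site.shift a.1.1 ν, a.1.2))⁻¹ * (V (a.1.1, ν))⁻¹)⁻¹ : Matrix.specialUnitaryGroup (Fin 2) ℂ) : Matrix (Fin 2) (Fin 2) ℂ) +
              ρ V a.1 ν 1 • vecQuat ((((V (Site.shift (a.1.1 - Pi.single ν 1) a.1.2, ν))⁻¹ * (V (a.1.1 - Pi.single ν 1, a.1.2))⁻¹ * V (a.1.1 - Pi.single ν 1, ν))⁻¹ : Matrix.specialUnitaryGroup (Fin 2) ℂ) : Matrix (Fin 2) (Fin 2) ℂ))‖) 2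
              (angle (∑ ν ∈ Finset.univ.erase a.1.2,
            (ρ V a.1 ν 0 • vecQuat (((V (Site.shift a.1.1 a.1.2, ν) * (V (Site.shift a.1.1 ν, a.1.2))⁻¹ * (V (a.1.1, ν))⁻¹)⁻¹ : Matrix.specialUnitaryGroup (Fin 2) ℂ) : Matrix (Fin 2) (Fin 2) ℂ) +
              ρ V a.1 ν 1 • vecQuat ((((V (Site.shift (a.1.1 - Pi.single ν 1) a.1.2, ν))⁻¹ * (V (a.1.1 - Pi.single ν 1, a.1.2))⁻¹ * V (a.1.1 - Pi.single ν 1, ν))⁻¹ : Matrix.specialUnitaryGroup (Fin 2) ℂ) : Matrix (Fin 2) (Fin 2) ℂ)))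
            (vecQuat ((V a.1 : Matrix.specialUnitaryGroup (Fin 2) ℂ) : Matrix (Fin 2) (Fin 2) ℂ)))))) F))^[t] μ₀).real A
            - (su2GibbsLaw S).real A| ≤ (1 - δ) ^ t := by
  have h := su2MaskedKick_fthmc_uniformlyErgodic (fun e : Edge d L => e.2 = μ ∧ χ e.1 = b)
    (fun (V : GaugeConfig d L (Matrix.specialUnitaryGroup (Fin 2) ℂ)) (e : Edge d L) => ∑ ν ∈ Finset.univ.erase e.2,
        (ρ V e ν 0 • vecQuat (((V (Site.shift e.1 e.2, ν) * (V (Site.shift e.1 ν, e.2))⁻¹ * (V (e.1, ν))⁻¹)⁻¹ : Matrix.specialUnitaryGroup (Fin 2) ℂ) : Matrix (Fin 2) (Fin 2) ℂ) +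
          ρ V e ν 1 • vecQuat ((((V (Site.shift (e.1 - Pi.single ν 1) e.2, ν))⁻¹ * (V (e.1 - Pi.single ν 1, e.2))⁻¹ * V (e.1 - Pi.single ν 1, ν))⁻¹ : Matrix.specialUnitaryGroup (Fin 2) ℂ) : Matrix (Fin 2) (Fin 2) ℂ)))
    (fun e _ => measurable_residualJ ρ e (hρm e))
    (fun V W hVW e he => residualJ_local χ hχ ρ he hVW (hρloc V W hVW e he))
    hκ₀ (fun V e he => (mul_le_mul_of_nonneg_left (norm_residualJ_le ρ V e) (abs_nonneg c)).trans (hκ V e he))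
    hε' hκ' hg hb0 hb hS hs
  beta_reduce at h
  exact h

end Residual

end Summit.Ventures.LatticeQCDFlow.Exactness
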